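import Literature.Analysis.FluidPDE.OseenDuhamelPairCalculus
import Literature.Analysis.ODE.AbelVolterraMajorants
import Mathlib.Analysis.SpecificLimits.Basic
import Mathlib.MeasureTheory.Constructions.BorelSpace.Metrizable
import HarnessLib

/-!
# The linearised Oseen problem `w = Φ - B_{t₀}(v, w) - B_{t₀}(w, v)` on a time window with a
  bounded coefficient: Picard construction and domination by the scalar majorants

Analysis/FluidPDE support file (three definitions — the linear map `linOseen`, the truncation
`windowTrunc`, the Picard iterates `linPicard` with their limit `linPicardLimit`, and one rate
constant; everything else proved) for the linear step, in FORCING form, of the perturbation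
theorem of M. P. Coiculescu, S. Palasek, *Non-uniqueness of smooth solutions of the
Navier–Stokes equations from critical data*, Invent. Math. 244 (2025) = arXiv:2503.14699,
Props. 4.2–4.3 with App. B, Prop. B.1 (hypothesis `hB` of
`Literature.Barriers.NavierStokesRegularity.CriticalDataSmoothNonuniqueness_of_principalParts_of_perturbationThreshold`).

On a window `(t₀, T]` on which the coefficient field `v` is bounded and jointly measurable, and
for a bounded jointly measurable free term `Φ`, the linear Volterra problem
`w(t) = Φ(t) - B_{t₀}(v, w)(t) - B_{t₀}(w, v)(t)` (`t ∈ (t₀, T]`; `B` the Oseen–Duhamel bilinear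
term of the tree, `oseenDuhamel 1 t₀`) — the mild form of the perturbed Stokes system
`∂ₜw - Δw + ℙ∇·(v ⊗ w + w ⊗ v) = (forcing)`, `w(t₀) = 0` of App. B, Prop. B.1 — is solved by
Picard iteration, a contraction in the weighted sup norm `sup_{t,x} e^{-λ(t-t₀)}‖w(t,x)‖` for
`λ = (12 C₀ M_v)² + 1` (`setIntegral_abelKernel_mul_exp_le`). Proved:

* `measurable_uncurry_linPicard`, `linPicard_eq_zero_of_not_mem`, `norm_linPicard_succ_sub_le`
  (geometric decay of the differences), `exists_norm_linPicard_le` (bounds);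
* `linPicardLimit` is jointly measurable, vanishes off the window, is bounded by
  `2 M_Φ e^{λ(T-t₀)}`, and SOLVES the equation on the window (`linPicardLimit_eq`);
* **domination** (`norm_linPicard_le_volterraMajorant`, `norm_linPicardLimit_le_of_dominates`):
  if `‖Φ(t)‖ ≤ φ(t)` and `‖v(t)‖ ≤ V(t)` on the window with `φ, V ≥ 0` continuous on `[t₀, T]`,
  the iterates are dominated slot by slot by the scalar Picard majorants
  `Literature.Analysis.ODE.volterraMajorant t₀ T (2C₀) φ V k`, hence the solution by any `R`
  dominating the continuous sub-solutions of `B ≤ φ + 2C₀ A[V B]` — the entry point of the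
  fractional Grönwall inequality (App. B, Lemma B.3) WITHOUT any continuity statement about `w`.

## Mathlib / tree search

Tree: `oseenDuhamel`, `oseenSliceConst`, `norm_oseenDuhamel_le_setIntegral`,
`norm_oseenDuhamel_le_const`, `measurable_uncurry_oseenDuhamel_from`,
`oseenDuhamel_window_sub_left/right`,
`setIntegral_abelKernel_mul_exp_le` (`OseenDuhamelPairCalculus.lean`); `abelOp`,
`volterraMajorant` and their API (`Analysis/ODE/AbelVolterraMajorants.lean`). Mathlib:
`cauchySeq_of_le_geometric_two`, `dist_le_of_le_geometric_two_of_tendsto`,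
`measurable_of_tendsto_metrizable`, `tendsto_pi_nhds`.

## References

* M. P. Coiculescu, S. Palasek, Invent. Math. 244 (2025) = arXiv:2503.14699: App. B, Prop. B.1
  (existence for the perturbed Stokes system) and the proof of Prop. 4.2. [`CoiculescuPalasek2025`]
* G. Koch, N. Nadirashvili, G. Seregin, V. Šverák, Acta Math. 203 (2009) = arXiv:0709.3599,
  §4 p. 8 (`u = U + B(u,u)` solved "as an ODE in `t`" on `L^∞`). [`KochNadirashviliSereginSverak2009`]
-/

noncomputable section

open MeasureTheory Set Function Filter
open _root_.Topology
open scoped ENNReal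

namespace Literature.Analysis.FluidPDE

open Literature.Analysis.ODE

variable {E : Type*} [NormedAddCommGroup E] [InnerProductSpace ℝ E] [FiniteDimensional ℝ E]
  [MeasurableSpace E] [BorelSpace E]

/-! ### The linear map, the truncation, the iterates -/

/-- **The linearised Oseen map** around the coefficient `v` from time `t₀`:
`L_{t₀}[v](w)(t)(x) = B_{t₀}(v, w)(t)(x) + B_{t₀}(w, v)(t)(x)` — the mild form of
`ℙ∇·(v ⊗ w + w ⊗ v)` integrated against the heat kernel (Coiculescu–Palasek, App. B, (B.1):
the linearisation `2ℙdiv(v ⊙ w)`). [cite: CoiculescuPalasek2025, App. B, Prop. B.1] -/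
def linOseen (t₀ : ℝ) (v w : ℝ → E → E) (t : ℝ) (x : E) : E :=
  oseenDuhamel 1 t₀ v w t x + oseenDuhamel 1 t₀ w v t x

/-- Truncation of a time-dependent field to the window `(t₀, T]` (zero outside). [folklore] -/
def windowTrunc (t₀ T : ℝ) (f : ℝ → E → E) (t : ℝ) (x : E) : E :=
  (Ioc t₀ T).indicator (fun s => f s x) t

/-- **Picard iterates** of `w = Φ - L_{t₀}[v](w)` on the window `(t₀, T]`:
`P₀ = 0`, `P_{k+1} = 𝟙_{(t₀,T]} (Φ - L_{t₀}[v](P_k))`. [cite: CoiculescuPalasek2025, App. B, Prop. B.1] -/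
def linPicard (t₀ T : ℝ) (v Φ : ℝ → E → E) : ℕ → ℝ → E → E
  | 0 => 0
  | k + 1 => windowTrunc t₀ T fun t x => Φ t x - linOseen t₀ v (linPicard t₀ T v Φ k) t x

/-- The pointwise limit of the Picard iterates (the solution of the linearised problem).
[cite: CoiculescuPalasek2025, App. B, Prop. B.1] -/
def linPicardLimit (t₀ T : ℝ) (v Φ : ℝ → E → E) (t : ℝ) (x : E) : E :=
  limUnder atTop fun k => linPicard t₀ T v Φ k t x

variable (E) in
/-- **The contraction rate** `λ(M) = (12 C₀ M)² + 1` of the weighted sup norm: for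
`‖v‖ ≤ M` one has `2 C₀ M · 3 λ^{-1/2} ≤ 1/2`. [folklore] -/
def linRate (M : ℝ) : ℝ :=
  (12 * oseenSliceConst E * M) ^ 2 + 1

/-- `λ(M) > 0`. [folklore] -/
theorem linRate_pos (M : ℝ) : 0 < linRate E M := by
  unfold linRate; positivity

/-- The contraction inequality `2 C₀ |M| · 3 λ(M)^{-1/2} ≤ 1/2`. [folklore] -/
theorem linRate_contraction (M : ℝ) :
    2 * oseenSliceConst E * |M| * (3 * linRate E M ^ (-(1 / 2 : ℝ))) ≤ 1 / 2 := by
  have hC := oseenSliceConst_pos (E := E)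
  have hl := linRate_pos (E := E) M
  rw [Real.rpow_neg hl.le, ← Real.sqrt_eq_rpow]
  have hs : 12 * oseenSliceConst E * |M| ≤ Real.sqrt (linRate E M) := by
    rw [show (12 * oseenSliceConst E * |M|) = Real.sqrt ((12 * oseenSliceConst E * M) ^ 2) by
      rw [Real.sqrt_sq_eq_abs, abs_mul, abs_mul, abs_of_pos hC,
        abs_of_pos (by norm_num : (0:ℝ) < 12)]]
    exact Real.sqrt_le_sqrt (by unfold linRate; linarith)
  have hsl : 0 < Real.sqrt (linRate E M) := Real.sqrt_pos.2 hl
  rw [show 2 * oseenSliceConst E * |M| * (3 * (Real.sqrt (linRate E M))⁻¹) =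
    (12 * oseenSliceConst E * |M|) / Real.sqrt (linRate E M) / 2 by field_simp; ring]
  rw [div_le_iff₀ (by norm_num : (0:ℝ) < 2), div_le_iff₀ hsl]
  linarith

/-! ### Measurability and support of the iterates -/

section Window

variable {t₀ T : ℝ} {v Φ : ℝ → E → E} {Mv MΦ : ℝ}

omit [InnerProductSpace ℝ E] [FiniteDimensional ℝ E] [BorelSpace E] in
/-- The truncation of a jointly measurable field is jointly measurable. [folklore] -/
theorem measurable_uncurry_windowTrunc {f : ℝ → E → E} (hf : Measurable (uncurry f)) :
    Measurable (uncurry (windowTrunc t₀ T f)) := by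
  have hs : MeasurableSet {q : ℝ × E | q.1 ∈ Ioc t₀ T} := measurable_fst measurableSet_Ioc
  have heq : uncurry (windowTrunc t₀ T f) = {q : ℝ × E | q.1 ∈ Ioc t₀ T}.indicator (uncurry f) := by
    funext q
    by_cases hq : q.1 ∈ Ioc t₀ T
    · simp only [uncurry, windowTrunc, indicator_of_mem hq,
        indicator_of_mem (show q ∈ {q : ℝ × E | q.1 ∈ Ioc t₀ T} from hq)]
    · simp only [uncurry, windowTrunc, indicator_of_notMem hq,
        indicator_of_notMem (show q ∉ {q : ℝ × E | q.1 ∈ Ioc t₀ T} from hq)]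
  rw [heq]
  exact hf.indicator hs

omit [InnerProductSpace ℝ E] [FiniteDimensional ℝ E] [MeasurableSpace E] [BorelSpace E] in
/-- Values of the truncation on the window. [folklore] -/
theorem windowTrunc_of_mem {f : ℝ → E → E} {t : ℝ} (ht : t ∈ Ioc t₀ T) (x : E) :
    windowTrunc t₀ T f t x = f t x := by
  simp only [windowTrunc, indicator_of_mem ht]

omit [InnerProductSpace ℝ E] [FiniteDimensional ℝ E] [MeasurableSpace E] [BorelSpace E] in
/-- The truncation vanishes off the window. [folklore] -/
theorem windowTrunc_of_not_mem {f : ℝ → E → E} {t : ℝ} (ht : t ∉ Ioc t₀ T) (x : E) :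
    windowTrunc t₀ T f t x = 0 := by
  simp only [windowTrunc, indicator_of_notMem ht]

/-- Joint measurability of the linearised map for jointly measurable fields. [folklore] -/
theorem measurable_uncurry_linOseen {w : ℝ → E → E} (hvm : Measurable (uncurry v))
    (hwm : Measurable (uncurry w)) : Measurable (uncurry (linOseen t₀ v w)) :=
  (measurable_uncurry_oseenDuhamel_from hvm hwm 1 t₀).add
    (measurable_uncurry_oseenDuhamel_from hwm hvm 1 t₀)

/-- **The Picard iterates are jointly measurable.** [folklore] -/
theorem measurable_uncurry_linPicard (hvm : Measurable (uncurry v)) (hΦm : Measurable (uncurry Φ))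
    (k : ℕ) : Measurable (uncurry (linPicard t₀ T v Φ k)) := by
  induction k with
  | zero => exact measurable_const
  | succ k ih =>
    exact measurable_uncurry_windowTrunc (hΦm.sub (measurable_uncurry_linOseen hvm ih))

/-- The Picard iterates vanish off the window. [folklore] -/
theorem linPicard_eq_zero_of_not_mem (k : ℕ) {t : ℝ} (ht : t ∉ Ioc t₀ T) (x : E) :
    linPicard t₀ T v Φ k t x = 0 := by
  cases k with
  | zero => rfl
  | succ k => exact windowTrunc_of_not_mem ht x

/-- The recursion on the window: `P_{k+1}(t)(x) = Φ(t)(x) - L_{t₀}[v](P_k)(t)(x)`, `t ∈ (t₀, T]`.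
[folklore] -/
theorem linPicard_succ_of_mem (k : ℕ) {t : ℝ} (ht : t ∈ Ioc t₀ T) (x : E) :
    linPicard t₀ T v Φ (k + 1) t x = Φ t x - linOseen t₀ v (linPicard t₀ T v Φ k) t x :=
  windowTrunc_of_mem ht x

/-! ### Bounds for the linearised map -/

/-- **Sup bound of the linearised map with time-dependent bounds**:
`‖L_{t₀}[v](w)(t)(x)‖ ≤ 2 C₀ ∫_{(t₀,t)} (t-τ)^{-1/2} V(τ) W(τ) dτ` when `‖v τ‖ ≤ V(τ)`,
`‖w τ‖ ≤ W(τ)` on `(t₀, t)` and the bound is integrable (twice `norm_oseenDuhamel_le_setIntegral`).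
[cite: CoiculescuPalasek2025, proof of Prop. 4.2 (terms II, III)] -/
theorem norm_linOseen_le {w : ℝ → E → E} {t : ℝ} {V W : ℝ → ℝ}
    (hv : ∀ τ ∈ Ioo t₀ t, ∀ y, ‖v τ y‖ ≤ V τ) (hw : ∀ τ ∈ Ioo t₀ t, ∀ y, ‖w τ y‖ ≤ W τ)
    (hint : IntegrableOn (fun τ => (t - τ) ^ (-(1 / 2 : ℝ)) * (V τ * W τ)) (Ioo t₀ t)) (x : E) :
    ‖linOseen t₀ v w t x‖ ≤
      2 * oseenSliceConst E * ∫ τ in Ioo t₀ t, (t - τ) ^ (-(1 / 2 : ℝ)) * (V τ * W τ) := by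
  have h1 := norm_oseenDuhamel_le_setIntegral hv hw hint x
  have hint' : IntegrableOn (fun τ => (t - τ) ^ (-(1 / 2 : ℝ)) * (W τ * V τ)) (Ioo t₀ t) :=
    hint.congr (Eventually.of_forall fun τ => by simp only [mul_comm (V τ)])
  have h2 := norm_oseenDuhamel_le_setIntegral hw hv hint' x
  have heq : ∫ τ in Ioo t₀ t, (t - τ) ^ (-(1 / 2 : ℝ)) * (W τ * V τ) =
      ∫ τ in Ioo t₀ t, (t - τ) ^ (-(1 / 2 : ℝ)) * (V τ * W τ) :=
    integral_congr_ae (Eventually.of_forall fun τ => by simp only [mul_comm (V τ)])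
  rw [heq] at h2
  calc ‖linOseen t₀ v w t x‖ ≤ ‖oseenDuhamel 1 t₀ v w t x‖ + ‖oseenDuhamel 1 t₀ w v t x‖ :=
        norm_add_le _ _
    _ ≤ _ := by linarith

/-- **Sup bound with constant bounds**: `‖L_{t₀}[v](w)(t)(x)‖ ≤ 2C₀ M_v M_w · 2√(t-t₀)`,
`t₀ ≤ t`. [folklore] -/
theorem norm_linOseen_le_const {w : ℝ → E → E} {t : ℝ} (ht : t₀ ≤ t) {Mw : ℝ}
    (hv : ∀ τ ∈ Ioo t₀ t, ∀ y, ‖v τ y‖ ≤ Mv) (hw : ∀ τ ∈ Ioo t₀ t, ∀ y, ‖w τ y‖ ≤ Mw) (x : E) :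
    ‖linOseen t₀ v w t x‖ ≤ 2 * oseenSliceConst E * (Mv * Mw) * (2 * Real.sqrt (t - t₀)) := by
  have h1 := norm_oseenDuhamel_le_const ht hv hw x
  have h2 := norm_oseenDuhamel_le_const ht hw hv x
  rw [mul_comm Mw Mv] at h2
  calc ‖linOseen t₀ v w t x‖ ≤ ‖oseenDuhamel 1 t₀ v w t x‖ + ‖oseenDuhamel 1 t₀ w v t x‖ :=
        norm_add_le _ _
    _ ≤ _ := by linarith

/-- **Linearity**: `L_{t₀}[v](w) - L_{t₀}[v](w') = L_{t₀}[v](w - w')` on bounded jointly measurable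
fields. [folklore] -/
theorem linOseen_sub {w w' : ℝ → E → E} {t : ℝ} {Mw Mw' : ℝ} (hvm : Measurable (uncurry v))
    (hwm : Measurable (uncurry w)) (hw'm : Measurable (uncurry w'))
    (hv : ∀ τ ∈ Ioo t₀ t, ∀ y, ‖v τ y‖ ≤ Mv) (hw : ∀ τ ∈ Ioo t₀ t, ∀ y, ‖w τ y‖ ≤ Mw)
    (hw' : ∀ τ ∈ Ioo t₀ t, ∀ y, ‖w' τ y‖ ≤ Mw') (x : E) :
    linOseen t₀ v w t x - linOseen t₀ v w' t x = linOseen t₀ v (w - w') t x := by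
  simp only [linOseen]
  rw [oseenDuhamel_window_sub_right hvm hwm hw'm hv hw hw' x,
    oseenDuhamel_window_sub_left hwm hw'm hvm hw hw' hv x]
  abel

/-! ### Bounds and differences of the iterates -/

/-- **Each Picard iterate is bounded** (by a constant depending on `k`). [folklore] -/
theorem exists_norm_linPicard_le (hvM : ∀ τ x, ‖v τ x‖ ≤ Mv)
    (hΦM : ∀ t x, ‖Φ t x‖ ≤ MΦ) (k : ℕ) :
    ∃ M : ℝ, 0 ≤ M ∧ ∀ t x, ‖linPicard t₀ T v Φ k t x‖ ≤ M := by
  induction k with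
  | zero => exact ⟨0, le_rfl, fun t x => by simp [linPicard]⟩
  | succ k ih =>
    obtain ⟨M, hM0, hM⟩ := ih
    have hMΦ : 0 ≤ MΦ := (norm_nonneg _).trans (hΦM t₀ 0)
    have hC : 0 < oseenSliceConst E := oseenSliceConst_pos
    refine ⟨MΦ + 2 * oseenSliceConst E * (|Mv| * M) * (2 * Real.sqrt (T - t₀)),
      by positivity, fun t x => ?_⟩
    by_cases ht : t ∈ Ioc t₀ T
    · rw [linPicard_succ_of_mem k ht]
      have hL := norm_linOseen_le_const ht.1.le (fun τ _ y => (hvM τ y).trans (le_abs_self _))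
        (fun τ _ y => hM τ y) x (v := v) (w := linPicard t₀ T v Φ k) (t₀ := t₀)
      have hsq : Real.sqrt (t - t₀) ≤ Real.sqrt (T - t₀) := Real.sqrt_le_sqrt (by linarith [ht.2])
      calc ‖Φ t x - linOseen t₀ v (linPicard t₀ T v Φ k) t x‖
          ≤ ‖Φ t x‖ + ‖linOseen t₀ v (linPicard t₀ T v Φ k) t x‖ := norm_sub_le _ _
        _ ≤ MΦ + 2 * oseenSliceConst E * (|Mv| * M) * (2 * Real.sqrt (t - t₀)) :=
            add_le_add (hΦM t x) hL
        _ ≤ MΦ + 2 * oseenSliceConst E * (|Mv| * M) * (2 * Real.sqrt (T - t₀)) := by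
            have hC := (oseenSliceConst_pos (E := E)).le
            gcongr
    · rw [linPicard_eq_zero_of_not_mem (k + 1) ht x, norm_zero]
      positivity

/-- **The differences of consecutive iterates solve the homogeneous recursion**:
`P_{k+2} - P_{k+1} = -L_{t₀}[v](P_{k+1} - P_k)` on the window. [folklore] -/
theorem linPicard_succ_sub (hvm : Measurable (uncurry v)) (hvM : ∀ τ x, ‖v τ x‖ ≤ Mv)
    (hΦm : Measurable (uncurry Φ)) (hΦM : ∀ t x, ‖Φ t x‖ ≤ MΦ) (k : ℕ) {t : ℝ} (ht : t ∈ Ioc t₀ T)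
    (x : E) :
    linPicard t₀ T v Φ (k + 2) t x - linPicard t₀ T v Φ (k + 1) t x =
      -linOseen t₀ v (linPicard t₀ T v Φ (k + 1) - linPicard t₀ T v Φ k) t x := by
  obtain ⟨M₁, -, hM₁⟩ := exists_norm_linPicard_le hvM hΦM (k + 1) (t₀ := t₀) (T := T) (Φ := Φ)
  obtain ⟨M₀, -, hM₀⟩ := exists_norm_linPicard_le hvM hΦM k (t₀ := t₀) (T := T) (Φ := Φ)
  rw [linPicard_succ_of_mem (k + 1) ht, linPicard_succ_of_mem k ht,
    ← linOseen_sub hvm (measurable_uncurry_linPicard hvm hΦm (k + 1))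
      (measurable_uncurry_linPicard hvm hΦm k) (fun τ _ y => hvM τ y) (fun τ _ y => hM₁ τ y)
      (fun τ _ y => hM₀ τ y) x]
  abel

/-- **Geometric decay of the differences in the weighted sup norm**:
`‖P_{k+1}(t,x) - P_k(t,x)‖ ≤ M_Φ 2^{-k} e^{λ(t-t₀)}` on the window, `λ = linRate E M_v`
(induction: `setIntegral_abelKernel_mul_exp_le` and `linRate_contraction`).
[cite: CoiculescuPalasek2025, App. B, Prop. B.1] -/
theorem norm_linPicard_succ_sub_le (hvm : Measurable (uncurry v))
    (hvM : ∀ τ x, ‖v τ x‖ ≤ Mv) (hΦm : Measurable (uncurry Φ)) (hΦM : ∀ t x, ‖Φ t x‖ ≤ MΦ)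
    (k : ℕ) {t : ℝ} (ht : t ∈ Ioc t₀ T) (x : E) :
    ‖linPicard t₀ T v Φ (k + 1) t x - linPicard t₀ T v Φ k t x‖ ≤
      MΦ * (2 : ℝ)⁻¹ ^ k * Real.exp (linRate E Mv * (t - t₀)) := by
  induction k generalizing t x with
  | zero =>
    rw [linPicard_succ_of_mem 0 ht, pow_zero, mul_one]
    have h0 : linOseen t₀ v (linPicard t₀ T v Φ 0) t x = 0 := by
      simp [linPicard, linOseen]
    have h1 : linPicard t₀ T v Φ 0 t x = 0 := rfl
    rw [h0, sub_zero, h1, sub_zero]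
    have h1 : (1 : ℝ) ≤ Real.exp (linRate E Mv * (t - t₀)) :=
      Real.one_le_exp (mul_nonneg (linRate_pos (E := E) Mv).le (by linarith [ht.1]))
    have hMΦ : 0 ≤ MΦ := (norm_nonneg _).trans (hΦM t₀ 0)
    calc ‖Φ t x‖ ≤ MΦ := hΦM t x
      _ = MΦ * 1 := (mul_one _).symm
      _ ≤ MΦ * Real.exp (linRate E Mv * (t - t₀)) := mul_le_mul_of_nonneg_left h1 hMΦ
  | succ k ih =>
    set lam := linRate E Mv with hlam
    have hl : 0 < lam := linRate_pos (E := E) Mv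
    have hMΦ : 0 ≤ MΦ := (norm_nonneg _).trans (hΦM t₀ 0)
    rw [show k + 1 + 1 = k + 2 from rfl, linPicard_succ_sub hvm hvM hΦm hΦM k ht x, norm_neg]
    -- the weighted bound of the previous difference on `(t₀, t)`
    have hW : ∀ τ ∈ Ioo t₀ t, ∀ y,
        ‖(linPicard t₀ T v Φ (k + 1) - linPicard t₀ T v Φ k) τ y‖ ≤
          MΦ * (2 : ℝ)⁻¹ ^ k * Real.exp (lam * (τ - t₀)) := by
      intro τ hτ y
      exact ih ⟨hτ.1, hτ.2.le.trans ht.2⟩ y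
    have hexpc : Continuous fun τ : ℝ => MΦ * (2 : ℝ)⁻¹ ^ k * Real.exp (lam * (τ - t₀)) := by
      fun_prop
    have hint : IntegrableOn (fun τ => (t - τ) ^ (-(1 / 2 : ℝ)) *
        (|Mv| * (MΦ * (2 : ℝ)⁻¹ ^ k * Real.exp (lam * (τ - t₀))))) (Ioo t₀ t) := by
      have hk : IntegrableOn (fun τ : ℝ => (t - τ) ^ (-(1 / 2 : ℝ))) (Ioo t₀ t) :=
        integrableOn_sub_rpow_Ioo (by norm_num)
      have hb : ∀ τ ∈ Ioo t₀ t, ‖|Mv| * (MΦ * (2 : ℝ)⁻¹ ^ k * Real.exp (lam * (τ - t₀)))‖ ≤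
          |Mv| * (MΦ * (2 : ℝ)⁻¹ ^ k * Real.exp (lam * (t - t₀))) := by
        intro τ hτ
        rw [Real.norm_of_nonneg (by positivity)]
        gcongr
        exact hτ.2.le
      refine Integrable.mono'
        (hk.norm.mul_const (|Mv| * (MΦ * (2 : ℝ)⁻¹ ^ k * Real.exp (lam * (t - t₀))))) ?_ ?_
      · exact ((measurable_sub_rpow_const t _).aestronglyMeasurable.mul
          (continuous_const.mul hexpc).aestronglyMeasurable).restrict
      · filter_upwards [ae_restrict_mem measurableSet_Ioo] with τ hτ
        rw [norm_mul]
        exact mul_le_mul_of_nonneg_left (hb τ hτ) (norm_nonneg _)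
    have hL := norm_linOseen_le (fun τ _ y => (hvM τ y).trans (le_abs_self Mv)) hW hint x
      (t₀ := t₀) (v := v)
    have hI := setIntegral_abelKernel_mul_exp_le hl ht.1.le (t := t) (t₀ := t₀)
    have hc := linRate_contraction (E := E) Mv
    rw [← hlam] at hc
    calc ‖linOseen t₀ v (linPicard t₀ T v Φ (k + 1) - linPicard t₀ T v Φ k) t x‖
        ≤ 2 * oseenSliceConst E * ∫ τ in Ioo t₀ t, (t - τ) ^ (-(1 / 2 : ℝ)) *
            (|Mv| * (MΦ * (2 : ℝ)⁻¹ ^ k * Real.exp (lam * (τ - t₀)))) := hL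
      _ = 2 * oseenSliceConst E * |Mv| * (MΦ * (2 : ℝ)⁻¹ ^ k) *
            ∫ τ in Ioo t₀ t, (t - τ) ^ (-(1 / 2 : ℝ)) * Real.exp (lam * (τ - t₀)) := by
          rw [← integral_const_mul, ← integral_const_mul]
          refine integral_congr_ae (Eventually.of_forall fun τ => ?_)
          ring
      _ ≤ 2 * oseenSliceConst E * |Mv| * (MΦ * (2 : ℝ)⁻¹ ^ k) *
            (3 * lam ^ (-(1 / 2 : ℝ)) * Real.exp (lam * (t - t₀))) := by
          have hC := (oseenSliceConst_pos (E := E)).le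
          exact mul_le_mul_of_nonneg_left hI (by positivity)
      _ = (2 * oseenSliceConst E * |Mv| * (3 * lam ^ (-(1 / 2 : ℝ)))) *
            (MΦ * (2 : ℝ)⁻¹ ^ k * Real.exp (lam * (t - t₀))) := by ring
      _ ≤ (1 / 2) * (MΦ * (2 : ℝ)⁻¹ ^ k * Real.exp (lam * (t - t₀))) :=
          mul_le_mul_of_nonneg_right hc (by positivity)
      _ = MΦ * (2 : ℝ)⁻¹ ^ (k + 1) * Real.exp (lam * (t - t₀)) := by rw [pow_succ]; ring

/-- Geometric decay everywhere (off the window both iterates vanish). [folklore] -/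
theorem dist_linPicard_succ_le (hvm : Measurable (uncurry v))
    (hvM : ∀ τ x, ‖v τ x‖ ≤ Mv) (hΦm : Measurable (uncurry Φ)) (hΦM : ∀ t x, ‖Φ t x‖ ≤ MΦ)
    (k : ℕ) (t : ℝ) (x : E) :
    dist (linPicard t₀ T v Φ k t x) (linPicard t₀ T v Φ (k + 1) t x) ≤
      MΦ * Real.exp (linRate E Mv * (T - t₀)) / 2 ^ k := by
  by_cases ht : t ∈ Ioc t₀ T
  · rw [dist_comm, dist_eq_norm]
    have hMΦ : 0 ≤ MΦ := (norm_nonneg _).trans (hΦM t₀ 0)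
    calc ‖linPicard t₀ T v Φ (k + 1) t x - linPicard t₀ T v Φ k t x‖
        ≤ MΦ * (2 : ℝ)⁻¹ ^ k * Real.exp (linRate E Mv * (t - t₀)) :=
          norm_linPicard_succ_sub_le hvm hvM hΦm hΦM k ht x
      _ ≤ MΦ * (2 : ℝ)⁻¹ ^ k * Real.exp (linRate E Mv * (T - t₀)) := by
          gcongr
          · exact (linRate_pos (E := E) Mv).le
          · exact ht.2
      _ = MΦ * Real.exp (linRate E Mv * (T - t₀)) / 2 ^ k := by
          rw [inv_pow]; ring
  · rw [linPicard_eq_zero_of_not_mem k ht x, linPicard_eq_zero_of_not_mem (k + 1) ht x, dist_self]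
    have hMΦ : 0 ≤ MΦ := (norm_nonneg _).trans (hΦM t₀ 0)
    positivity

/-- Geometric decay in the normal form of `cauchySeq_of_le_geometric_two`. [folklore] -/
theorem dist_linPicard_succ_le' (hvm : Measurable (uncurry v))
    (hvM : ∀ τ x, ‖v τ x‖ ≤ Mv) (hΦm : Measurable (uncurry Φ)) (hΦM : ∀ t x, ‖Φ t x‖ ≤ MΦ)
    (k : ℕ) (t : ℝ) (x : E) :
    dist (linPicard t₀ T v Φ k t x) (linPicard t₀ T v Φ (k + 1) t x) ≤
      2 * (MΦ * Real.exp (linRate E Mv * (T - t₀))) / 2 / 2 ^ k := by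
  rw [mul_div_cancel_left₀ _ (two_ne_zero' ℝ)]
  exact dist_linPicard_succ_le hvm hvM hΦm hΦM k t x

/-! ### The limit -/

/-- **Convergence of the Picard iterates** to `linPicardLimit`, pointwise. [folklore] -/
theorem tendsto_linPicard (hvm : Measurable (uncurry v)) (hvM : ∀ τ x, ‖v τ x‖ ≤ Mv)
    (hΦm : Measurable (uncurry Φ)) (hΦM : ∀ t x, ‖Φ t x‖ ≤ MΦ) (t : ℝ) (x : E) :
    Tendsto (fun k => linPicard t₀ T v Φ k t x) atTop (𝓝 (linPicardLimit t₀ T v Φ t x)) := by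
  haveI : CompleteSpace E := FiniteDimensional.complete ℝ E
  have hc : CauchySeq fun k => linPicard t₀ T v Φ k t x :=
    cauchySeq_of_le_geometric_two (dist_linPicard_succ_le' hvm hvM hΦm hΦM · t x)
  exact hc.tendsto_limUnder

/-- **Rate of convergence**: `‖P_k(t,x) - w(t,x)‖ ≤ 2 M_Φ e^{λ(T-t₀)} / 2^k`. [folklore] -/
theorem norm_linPicard_sub_linPicardLimit_le (hvm : Measurable (uncurry v))
    (hvM : ∀ τ x, ‖v τ x‖ ≤ Mv) (hΦm : Measurable (uncurry Φ)) (hΦM : ∀ t x, ‖Φ t x‖ ≤ MΦ)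
    (k : ℕ) (t : ℝ) (x : E) :
    ‖linPicard t₀ T v Φ k t x - linPicardLimit t₀ T v Φ t x‖ ≤
      2 * (MΦ * Real.exp (linRate E Mv * (T - t₀))) / 2 ^ k := by
  rw [← dist_eq_norm]
  exact dist_le_of_le_geometric_two_of_tendsto (dist_linPicard_succ_le' hvm hvM hΦm hΦM · t x)
    (tendsto_linPicard hvm hvM hΦm hΦM t x) k

/-- **The limit is jointly measurable** (pointwise limit of jointly measurable fields).
[folklore] -/
theorem measurable_uncurry_linPicardLimit (hvm : Measurable (uncurry v))
    (hvM : ∀ τ x, ‖v τ x‖ ≤ Mv) (hΦm : Measurable (uncurry Φ)) (hΦM : ∀ t x, ‖Φ t x‖ ≤ MΦ) :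
    Measurable (uncurry (linPicardLimit t₀ T v Φ)) := by
  refine measurable_of_tendsto_metrizable (f := fun k => uncurry (linPicard t₀ T v Φ k))
    (measurable_uncurry_linPicard hvm hΦm) ?_
  rw [tendsto_pi_nhds]
  intro q
  exact tendsto_linPicard hvm hvM hΦm hΦM q.1 q.2

/-- The limit vanishes off the window. [folklore] -/
theorem linPicardLimit_eq_zero_of_not_mem (hvm : Measurable (uncurry v))
    (hvM : ∀ τ x, ‖v τ x‖ ≤ Mv) (hΦm : Measurable (uncurry Φ)) (hΦM : ∀ t x, ‖Φ t x‖ ≤ MΦ)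
    {t : ℝ} (ht : t ∉ Ioc t₀ T) (x : E) : linPicardLimit t₀ T v Φ t x = 0 := by
  have h := tendsto_linPicard hvm hvM hΦm hΦM t x (t₀ := t₀) (T := T) (v := v) (Φ := Φ)
  have h0 : (fun k => linPicard t₀ T v Φ k t x) = fun _ => 0 :=
    funext fun k => linPicard_eq_zero_of_not_mem k ht x
  rw [h0] at h
  exact tendsto_nhds_unique h tendsto_const_nhds

/-- **The limit is bounded**: `‖w(t,x)‖ ≤ 2 M_Φ e^{λ(T-t₀)}`. [folklore] -/
theorem norm_linPicardLimit_le (hvm : Measurable (uncurry v))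
    (hvM : ∀ τ x, ‖v τ x‖ ≤ Mv) (hΦm : Measurable (uncurry Φ)) (hΦM : ∀ t x, ‖Φ t x‖ ≤ MΦ)
    (t : ℝ) (x : E) :
    ‖linPicardLimit t₀ T v Φ t x‖ ≤ 2 * MΦ * Real.exp (linRate E Mv * (T - t₀)) := by
  have h := norm_linPicard_sub_linPicardLimit_le hvm hvM hΦm hΦM 0 t x
    (t₀ := t₀) (T := T) (v := v) (Φ := Φ)
  simp only [linPicard, Pi.zero_apply, zero_sub, norm_neg, pow_zero, div_one] at h
  linarith

/-- Bounds of the iterates uniform in `k`: `‖P_k(t,x)‖ ≤ 4 M_Φ e^{λ(T-t₀)}`. [folklore] -/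
theorem norm_linPicard_le_uniform (hvm : Measurable (uncurry v))
    (hvM : ∀ τ x, ‖v τ x‖ ≤ Mv) (hΦm : Measurable (uncurry Φ)) (hΦM : ∀ t x, ‖Φ t x‖ ≤ MΦ)
    (k : ℕ) (t : ℝ) (x : E) :
    ‖linPicard t₀ T v Φ k t x‖ ≤ 4 * MΦ * Real.exp (linRate E Mv * (T - t₀)) := by
  have h1 := norm_linPicard_sub_linPicardLimit_le hvm hvM hΦm hΦM k t x
    (t₀ := t₀) (T := T) (v := v) (Φ := Φ)
  have h2 := norm_linPicardLimit_le hvm hvM hΦm hΦM t x (t₀ := t₀) (T := T) (v := v) (Φ := Φ)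
  have hMΦ : 0 ≤ MΦ := (norm_nonneg _).trans (hΦM t₀ 0)
  have h3 : 2 * (MΦ * Real.exp (linRate E Mv * (T - t₀))) / 2 ^ k ≤
      2 * (MΦ * Real.exp (linRate E Mv * (T - t₀))) :=
    div_le_self (by positivity) (one_le_pow₀ (by norm_num))
  calc ‖linPicard t₀ T v Φ k t x‖
      ≤ ‖linPicard t₀ T v Φ k t x - linPicardLimit t₀ T v Φ t x‖ + ‖linPicardLimit t₀ T v Φ t x‖ :=
        norm_le_norm_sub_add _ _
    _ ≤ _ := by linarith

/-- **The limit solves the linearised problem on the window**: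
`w(t)(x) = Φ(t)(x) - L_{t₀}[v](w)(t)(x)` for `t ∈ (t₀, T]` (pass to the limit in the recursion;
`L_{t₀}[v](P_k) → L_{t₀}[v](w)` uniformly by linearity and the sup bound).
[cite: CoiculescuPalasek2025, App. B, Prop. B.1] -/
theorem linPicardLimit_eq (hvm : Measurable (uncurry v))
    (hvM : ∀ τ x, ‖v τ x‖ ≤ Mv) (hΦm : Measurable (uncurry Φ)) (hΦM : ∀ t x, ‖Φ t x‖ ≤ MΦ)
    {t : ℝ} (ht : t ∈ Ioc t₀ T) (x : E) :
    linPicardLimit t₀ T v Φ t x = Φ t x - linOseen t₀ v (linPicardLimit t₀ T v Φ) t x := by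
  set w := linPicardLimit t₀ T v Φ with hw
  set P := linPicard t₀ T v Φ with hP
  set K := MΦ * Real.exp (linRate E Mv * (T - t₀)) with hK
  have hMΦ : 0 ≤ MΦ := (norm_nonneg _).trans (hΦM t₀ 0)
  have hK0 : 0 ≤ K := by positivity
  have hwm : Measurable (uncurry w) := measurable_uncurry_linPicardLimit hvm hvM hΦm hΦM
  have hwM : ∀ τ y, ‖w τ y‖ ≤ 2 * K := fun τ y => by
    have := norm_linPicardLimit_le hvm hvM hΦm hΦM τ y (t₀ := t₀) (T := T) (Φ := Φ) (v := v)
    rw [hK]; linarith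
  -- the right-hand sides converge
  have hlin : Tendsto (fun k => Φ t x - linOseen t₀ v (P k) t x) atTop
      (𝓝 (Φ t x - linOseen t₀ v w t x)) := by
    refine tendsto_const_nhds.sub ?_
    rw [Metric.tendsto_atTop]
    intro ε hε
    -- choose `k₀` with `2K/2^k · (2C₀|Mv| 2√(T-t₀)) < ε` for `k ≥ k₀`
    set A : ℝ := 2 * oseenSliceConst E * (|Mv| * 1) * (2 * Real.sqrt (T - t₀)) + 1 with hA
    have hA0 : 0 < A := by
      have := (oseenSliceConst_pos (E := E)).le
      positivity
    obtain ⟨k₀, hk₀⟩ : ∃ k₀ : ℕ, 2 * K / 2 ^ k₀ < ε / A := by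
      have h : Tendsto (fun k : ℕ => 2 * K / 2 ^ k) atTop (𝓝 0) := by
        have h1 := tendsto_pow_atTop_nhds_zero_of_lt_one (r := (2 : ℝ)⁻¹) (by norm_num) (by norm_num)
        have h2 := h1.const_mul (2 * K)
        rw [mul_zero] at h2
        refine h2.congr fun k => ?_
        rw [inv_pow, div_eq_mul_inv]
      exact ((h.eventually (gt_mem_nhds (div_pos hε hA0))).and (eventually_ge_atTop 0)).exists.imp
        fun k hk => hk.1
    refine ⟨k₀, fun k hk => ?_⟩
    have hrate : ∀ τ y, ‖(P k - w) τ y‖ ≤ 2 * K / 2 ^ k₀ := by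
      intro τ y
      have h := norm_linPicard_sub_linPicardLimit_le hvm hvM hΦm hΦM k τ y
        (t₀ := t₀) (T := T) (Φ := Φ) (v := v)
      calc ‖(P k - w) τ y‖ = ‖P k τ y - w τ y‖ := rfl
        _ ≤ 2 * K / 2 ^ k := h
        _ ≤ 2 * K / 2 ^ k₀ := by
            refine div_le_div_of_nonneg_left (by positivity) (by positivity) ?_
            exact pow_le_pow_right₀ (by norm_num) hk
    rw [dist_eq_norm, linOseen_sub hvm (measurable_uncurry_linPicard hvm hΦm k) hwm
      (fun τ _ y => hvM τ y) (fun τ _ y => norm_linPicard_le_uniform hvm hvM hΦm hΦM k τ y)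
      (fun τ _ y => hwM τ y) x]
    have hL := norm_linOseen_le_const ht.1.le (fun τ _ y => (hvM τ y).trans (le_abs_self Mv))
      (fun τ _ y => hrate τ y) x (t₀ := t₀) (v := v) (w := P k - w)
    have hsq : Real.sqrt (t - t₀) ≤ Real.sqrt (T - t₀) := Real.sqrt_le_sqrt (by linarith [ht.2])
    calc ‖linOseen t₀ v (P k - w) t x‖
        ≤ 2 * oseenSliceConst E * (|Mv| * (2 * K / 2 ^ k₀)) * (2 * Real.sqrt (t - t₀)) := hL
      _ ≤ 2 * oseenSliceConst E * (|Mv| * (2 * K / 2 ^ k₀)) * (2 * Real.sqrt (T - t₀)) := by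
          have := (oseenSliceConst_pos (E := E)).le
          gcongr
      _ = (2 * oseenSliceConst E * (|Mv| * 1) * (2 * Real.sqrt (T - t₀))) * (2 * K / 2 ^ k₀) := by
          ring
      _ ≤ A * (2 * K / 2 ^ k₀) := by
          refine mul_le_mul_of_nonneg_right (by rw [hA]; linarith) (by positivity)
      _ < A * (ε / A) := mul_lt_mul_of_pos_left hk₀ hA0
      _ = ε := mul_div_cancel₀ ε hA0.ne'
  -- the left-hand sides converge to `w t x`; they are equal for every `k`
  have hshift : Tendsto (fun k => P (k + 1) t x) atTop (𝓝 (w t x)) :=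
    (tendsto_linPicard hvm hvM hΦm hΦM t x).comp (tendsto_add_atTop_nat 1)
  have heq : (fun k => P (k + 1) t x) = fun k => Φ t x - linOseen t₀ v (P k) t x :=
    funext fun k => linPicard_succ_of_mem k ht x
  rw [heq] at hshift
  exact tendsto_nhds_unique hshift hlin

/-! ### Domination by the scalar majorants -/

/-- **The iterates are dominated by the scalar Picard majorants**: if `‖Φ(t,x)‖ ≤ φ(t)` and
`‖v(t,x)‖ ≤ V(t)` on the window with `φ, V ≥ 0` continuous on `[t₀, T]`, then
`‖P_k(t,x)‖ ≤ B_k(t)`, `B_k = volterraMajorant t₀ T (2C₀) φ V k` (induction with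
`norm_linOseen_le`). [cite: CoiculescuPalasek2025, App. B, Prop. B.1 and proof of Prop. 4.2] -/
theorem norm_linPicard_le_volterraMajorant {φ V : ℝ → ℝ} (hφ : ContinuousOn φ (Icc t₀ T))
    (hV : ContinuousOn V (Icc t₀ T)) (hφ0 : ∀ t ∈ Icc t₀ T, 0 ≤ φ t)
    (hV0 : ∀ t ∈ Icc t₀ T, 0 ≤ V t) (hΦφ : ∀ t ∈ Ioc t₀ T, ∀ x, ‖Φ t x‖ ≤ φ t)
    (hvV : ∀ τ ∈ Ioc t₀ T, ∀ y, ‖v τ y‖ ≤ V τ) (k : ℕ) :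
    ∀ t ∈ Ioc t₀ T, ∀ x, ‖linPicard t₀ T v Φ k t x‖ ≤
      volterraMajorant t₀ T (2 * oseenSliceConst E) φ V k t := by
  have hC : 0 ≤ 2 * oseenSliceConst E := by
    have := (oseenSliceConst_pos (E := E)).le; positivity
  induction k with
  | zero => intro t _ x; simp [linPicard]
  | succ k ih =>
    intro t ht x
    rw [linPicard_succ_of_mem k ht, volterraMajorant_succ]
    set B := volterraMajorant t₀ T (2 * oseenSliceConst E) φ V k with hB
    have hBc : ContinuousOn B (Icc t₀ T) := continuousOn_volterraMajorant hφ hV k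
    have hB0 : ∀ τ ∈ Icc t₀ T, 0 ≤ B τ := volterraMajorant_nonneg hC hφ0 hV0 k
    -- the integrand `V B` is bounded and measurable on `(t₀, t)`
    obtain ⟨M, hM⟩ := exists_abs_le_of_continuousOn_Icc (hV.mul hBc) (t₀ := t₀) (T := T)
    have hsub : Ioo t₀ t ⊆ Ioc t₀ T := fun τ hτ => ⟨hτ.1, hτ.2.le.trans ht.2⟩
    have hint : IntegrableOn (fun τ => (t - τ) ^ (-(1 / 2 : ℝ)) * (V τ * B τ)) (Ioo t₀ t) := by
      refine integrableOn_abelKernel_mul (M := M) ?_ fun τ hτ => hM τ (Ioc_subset_Icc_self (hsub hτ))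
      have hc : ContinuousOn (fun τ => V τ * B τ) (Ioo t₀ t) :=
        (hV.mul hBc).mono fun τ hτ => Ioc_subset_Icc_self (hsub hτ)
      exact hc.aestronglyMeasurable measurableSet_Ioo
    have hL := norm_linOseen_le (fun τ hτ y => hvV τ (hsub hτ) y) (fun τ hτ y => ih τ (hsub hτ) y)
      hint x (t₀ := t₀) (v := v) (w := linPicard t₀ T v Φ k)
    have hind : abelOp t₀ ((Ioc t₀ T).indicator fun τ => V τ * B τ) t =
        ∫ τ in Ioo t₀ t, (t - τ) ^ (-(1 / 2 : ℝ)) * (V τ * B τ) := by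
      rw [abelOp_apply]
      refine setIntegral_congr_fun measurableSet_Ioo fun τ hτ => ?_
      rw [indicator_of_mem (hsub hτ)]
    calc ‖Φ t x - linOseen t₀ v (linPicard t₀ T v Φ k) t x‖
        ≤ ‖Φ t x‖ + ‖linOseen t₀ v (linPicard t₀ T v Φ k) t x‖ := norm_sub_le _ _
      _ ≤ φ t + 2 * oseenSliceConst E * ∫ τ in Ioo t₀ t, (t - τ) ^ (-(1 / 2 : ℝ)) * (V τ * B τ) :=
          add_le_add (hΦφ t ht x) hL
      _ = φ t + 2 * oseenSliceConst E * abelOp t₀ ((Ioc t₀ T).indicator fun τ => V τ * B τ) t := by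
          rw [hind]

/-- **Domination of the solution by any Grönwall bound.** Under the hypotheses of
`norm_linPicard_le_volterraMajorant` and the boundedness/measurability hypotheses of the
construction: if `R` dominates every continuous non-negative sub-solution of
`B ≤ φ + 2C₀ A[V B]` on `[t₀, T]`, then `‖w(t,x)‖ ≤ R(t)` on the window
(`volterraMajorant_le_of_dominates` and the pointwise convergence of the iterates). This is where
the fractional Grönwall inequality (App. B, Lemma B.3) enters, with no continuity statement about
`w` itself. [cite: CoiculescuPalasek2025, App. B, Prop. B.1 with Lemma B.3] -/
theorem norm_linPicardLimit_le_of_dominates (hvm : Measurable (uncurry v))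
    (hvM : ∀ τ x, ‖v τ x‖ ≤ Mv) (hΦm : Measurable (uncurry Φ)) (hΦM : ∀ t x, ‖Φ t x‖ ≤ MΦ)
    {φ V : ℝ → ℝ} (hφ : ContinuousOn φ (Icc t₀ T)) (hV : ContinuousOn V (Icc t₀ T))
    (hφ0 : ∀ t ∈ Icc t₀ T, 0 ≤ φ t) (hV0 : ∀ t ∈ Icc t₀ T, 0 ≤ V t)
    (hΦφ : ∀ t ∈ Ioc t₀ T, ∀ x, ‖Φ t x‖ ≤ φ t) (hvV : ∀ τ ∈ Ioc t₀ T, ∀ y, ‖v τ y‖ ≤ V τ)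
    {R : ℝ → ℝ}
    (hR : ∀ B : ℝ → ℝ, ContinuousOn B (Icc t₀ T) → (∀ t ∈ Icc t₀ T, 0 ≤ B t) →
      (∀ t ∈ Icc t₀ T, B t ≤ φ t + 2 * oseenSliceConst E * abelOp t₀ (fun τ => V τ * B τ) t) →
      ∀ t ∈ Icc t₀ T, B t ≤ R t)
    {t : ℝ} (ht : t ∈ Ioc t₀ T) (x : E) : ‖linPicardLimit t₀ T v Φ t x‖ ≤ R t := by
  have hC : 0 ≤ 2 * oseenSliceConst E := by
    have := (oseenSliceConst_pos (E := E)).le; positivity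
  have hk : ∀ k, ‖linPicard t₀ T v Φ k t x‖ ≤ R t := fun k =>
    (norm_linPicard_le_volterraMajorant hφ hV hφ0 hV0 hΦφ hvV k t ht x).trans
      (volterraMajorant_le_of_dominates hC hφ hV hφ0 hV0 hR k t (Ioc_subset_Icc_self ht))
  exact le_of_tendsto ((tendsto_linPicard hvm hvM hΦm hΦM t x).norm) (Eventually.of_forall hk)

end Window

end Literature.Analysis.FluidPDE
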